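import Mathlib
import Literature.AlgebraicGeometry.Resolution.CobordantGame
import Summits.ResolutionOfSingularities.ResolutionOfSingularities.Theorems.WeightedInvariantLocalWeightedDropGradedSliceTwistedRecentre
import Summits.ResolutionOfSingularities.ResolutionOfSingularities.Theorems.WeightedInvariantLocalWeightedDropGradedSliceWildSaturated

/-!
# `WeightedInvariant.LocalWeightedDrop`: the wild slice clause — **THE SAME-RANK TRANSFER HOLDS ALONG POINTWISE-SATURATED PLAYS**
# (`PSatWonBy`: saturation asked only at the points that carry a singular successor of the slice)

Route `ResolutionOfSingularities/WeightedInvariant`, crux `LocalWeightedDrop` (stmt-ResolutionOfSingularities-8899).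
[OURS · L1 W4.3] — res-type-060 (gen 10), WILD LIBRARY file 20; sharpens file 18 (`…GradedSliceWildSaturated`, p533697: UNIFORM saturation)
with file 19 (`…GradedSliceTwistedRecentre`: the saturation-free successor correspondence and the re-centring at a point).  Nothing here is a
statement of the manuscript under review on ladder RESOLUTION; not a verdict on ideator res-L1-w43-idea-1's card A.  AI proof, weaker than
expert review.

## The statement
At a WILD frozen coordinate of minimal valuation the one-sided slice transfer T3″ «slice graded-won with rank α ⇒ successor graded-won with
rank α» holds whenever the slice's winning play is POINTWISE SATURATED: at every exceptional point `c` of every move `(θ, W)` of the play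
THAT CARRIES A SINGULAR SUCCESSOR there is a residue `m` with `τⱼ ≡ m·Wⱼ (mod q)` on the coordinates TRANSLATED at `c` (`τ` the twist
residues carried along: `(1; −wⱼ)` at the wild point, `(m; τⱼ − m·Wⱼ)` after the point) — i.e. the point is fixed by the twist group
`μ_q` up to the new torus (memo L/res-type-060-w43/WILD-SLICE-CLAUSE.md §9(b)).  This subsumes: the tame theorem p515424 (`q = 1`,
`psatWonBy_one_of_gradedWonBy`), res-type-099's rank-`0` floor p529887 (`psatWonBy_zero_iff`: at rank `0` there is no singular successor and
the side condition is void), and the uniform theorem p533697 (`psatWonBy_of_satWonBy`).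

* `PSatWonBy q α N L τ f` (definition by well-founded recursion) and the three comparison lemmas above; `gradedWonBy_of_psatWonBy`.
* **`gradedWonBy_twistedCyl_of_psatWonBy`** — MAIN INDUCTION for twisted cylinders TC(G, h, τ, a) over a pointwise-SAT-won slice.  Step:
  conjugate `θ` through the twist (res-type-099's `conjMove`/`subst_frobFamily_subst_conjMove`), play `(id, (W, 0))`; at a singular
  successor `G₁` at `γ`: `isSuccessorAt_of_frobCover` (file 19) exhibits the slice's singular successor `h₁` at `γ|_{old}` with the same
  exponent — this RELEASES the residue `m` of the point; `exists_exact_saturation` (file 17) makes it exact data `(m', K)`;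
  `isSuccessorAt_of_twistedCyl_pointwise` (file 19) shows the RE-CENTRED successor `G₁ ∘ (𝒪_K ⊔ y)` is a twisted cylinder over `h₁`; the
  induction hypothesis and the transfer along the graded invertible re-centring (p527298) finish.
* **`gradedWonBy_of_slice_wild_psat`** — the theorem at the wild point, hypotheses of the (S2) stub verbatim plus `PSatWonBy` of the slice for
  the residues `wildTau mod q`.

What stays open: whether every graded win of a slice can be reorganised into a pointwise-saturated one of the same rank (⟸ (W-min)); off
saturation the successor structure is of translation type (file 19 §1) and its rank is governed by auxiliary germs (memo §9(d)).
-/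

set_option linter.dupNamespace false -- mandated namespace of this single-conjunct summit
set_option autoImplicit false

namespace Summit.ResolutionOfSingularities.ResolutionOfSingularities.Theorems

namespace GradedGame

open MvPowerSeries
open Literature.AlgebraicGeometry.Resolution
open Literature.AlgebraicGeometry.Resolution.FormalCoordChange (linMat)

variable {k : Type} [Field k]

/-! ## POINTWISE-SAT-WON: saturation only at the points that carry a singular successor -/

section PSatGame

/-- **POINTWISE-SAT-WON with rank `< α`** (twist modulus `q`, twist residues `τ : Fin N → ZMod q` on the coordinates): the Prover plays
`L`-graded moves `(θ, w)`; at every exceptional point `c` CARRYING A SINGULAR SUCCESSOR there is a residue `m` with `τⱼ = m·wⱼ (mod q)`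
on the TRANSLATED coordinates of `c` (the point is fixed by the twist group `μ_q` up to the new torus), and that successor is
pointwise-SAT-won with smaller rank for the propagated lattice and the propagated residues `(m ; τⱼ − m·wⱼ)`.  For `α = 0` this is
`GradedWonBy 0` (no singular successors: `psatWonBy_zero_iff`); for `q = 1` every graded win qualifies (`psatWonBy_one_of_gradedWonBy`);
a uniform SAT-win (file 18 `SatWonBy`) qualifies (`psatWonBy_of_satWonBy`). [OURS · L1 W4.3] -/
def PSatWonBy (q : ℕ) : Ordinal.{0} → (N : ℕ) → AddSubgroup (Fin N → ℤ) → (Fin N → ZMod q) → MvPowerSeries (Fin N) k → Prop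
  | α, N, L, τ, f => ∃ (θ : Fin N → MvPowerSeries (Fin N) k) (w : Fin N → ℕ), IsLGradedMove L θ w ∧
      ∀ (c : Fin N → k) (a : ℕ) (g : MvPowerSeries (Fin (N + 1)) k), IsSuccessorAt f θ w c a g →
        ∃ (m : ZMod q), (∀ j, c j ≠ 0 → 0 < w j → τ j = m * (w j : ZMod q)) ∧
          ∃ (β : Ordinal.{0}) (_ : β < α),
            PSatWonBy q β (N + 1) (succLattice L w c) (Fin.cons m fun j => τ j - m * (w j : ZMod q)) g
  termination_by α => α

/-- Unfolding of `PSatWonBy`. [OURS · L1 W4.3] -/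
theorem psatWonBy_iff (q : ℕ) (α : Ordinal.{0}) {N : ℕ} (L : AddSubgroup (Fin N → ℤ)) (τ : Fin N → ZMod q)
    (f : MvPowerSeries (Fin N) k) :
    PSatWonBy q α N L τ f ↔ ∃ (θ : Fin N → MvPowerSeries (Fin N) k) (w : Fin N → ℕ), IsLGradedMove L θ w ∧
      ∀ (c : Fin N → k) (a : ℕ) (g : MvPowerSeries (Fin (N + 1)) k), IsSuccessorAt f θ w c a g →
        ∃ (m : ZMod q), (∀ j, c j ≠ 0 → 0 < w j → τ j = m * (w j : ZMod q)) ∧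
          ∃ β, β < α ∧ PSatWonBy q β (N + 1) (succLattice L w c) (Fin.cons m fun j => τ j - m * (w j : ZMod q)) g := by
  rw [PSatWonBy]
  simp only [exists_prop]

/-- Pointwise-SAT-wins are graded wins (forget the residues). [OURS · L1 W4.3] -/
theorem gradedWonBy_of_psatWonBy (q : ℕ) (α : Ordinal.{0}) :
    ∀ {N : ℕ} (L : AddSubgroup (Fin N → ℤ)) (τ : Fin N → ZMod q) (f : MvPowerSeries (Fin N) k),
      PSatWonBy q α N L τ f → GradedWonBy α N L f := by
  induction α using WellFoundedLT.induction with
  | ind α ih =>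
    intro N L τ f h
    rw [psatWonBy_iff] at h
    obtain ⟨θ, w, hθ, hs⟩ := h
    rw [gradedWonBy_iff]
    refine ⟨θ, w, hθ, fun c a g hg => ?_⟩
    obtain ⟨m, -, β, hβ, hW⟩ := hs c a g hg
    exact ⟨β, hβ, ih β hβ _ _ g hW⟩

/-- At rank `0` (no singular successors) the side condition is vacuous: `PSatWonBy q 0 = GradedWonBy 0`. [OURS · L1 W4.3] -/
theorem psatWonBy_zero_iff (q : ℕ) {N : ℕ} (L : AddSubgroup (Fin N → ℤ)) (τ : Fin N → ZMod q) (f : MvPowerSeries (Fin N) k) :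
    PSatWonBy q 0 N L τ f ↔ GradedWonBy 0 N L f := by
  rw [psatWonBy_iff, gradedWonBy_zero_iff]
  refine exists_congr fun θ => exists_congr fun w => and_congr_right fun _ => ?_
  refine forall_congr' fun c => forall_congr' fun a => forall_congr' fun g => ⟨fun h hg => ?_, fun h hg => absurd hg h⟩
  obtain ⟨-, -, β, hβ, -⟩ := h hg
  exact absurd hβ (by simp)

/-- For the trivial twist (`q = 1`, the TAME case) every graded win is a pointwise-SAT-win. [OURS · L1 W4.3] -/
theorem psatWonBy_one_of_gradedWonBy (α : Ordinal.{0}) :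
    ∀ {N : ℕ} (L : AddSubgroup (Fin N → ℤ)) (τ : Fin N → ZMod 1) (f : MvPowerSeries (Fin N) k),
      GradedWonBy α N L f → PSatWonBy 1 α N L τ f := by
  induction α using WellFoundedLT.induction with
  | ind α ih =>
    intro N L τ f h
    rw [gradedWonBy_iff] at h
    obtain ⟨θ, w, hθ, hs⟩ := h
    rw [psatWonBy_iff]
    refine ⟨θ, w, hθ, fun c a g hg => ⟨0, fun j _ _ => Subsingleton.elim _ _, ?_⟩⟩
    obtain ⟨β, hβ, hW⟩ := hs c a g hg
    exact ⟨β, hβ, ih β hβ _ _ g hW⟩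

/-- A uniform SAT-win (file 18) is a pointwise-SAT-win. [OURS · L1 W4.3] -/
theorem psatWonBy_of_satWonBy (q : ℕ) (α : Ordinal.{0}) :
    ∀ {N : ℕ} (L : AddSubgroup (Fin N → ℤ)) (τ : Fin N → ZMod q) (f : MvPowerSeries (Fin N) k),
      SatWonBy q α N L τ f → PSatWonBy q α N L τ f := by
  induction α using WellFoundedLT.induction with
  | ind α ih =>
    intro N L τ f h
    rw [satWonBy_iff] at h
    obtain ⟨θ, w, m, hθ, hsat, hs⟩ := h
    rw [psatWonBy_iff]
    refine ⟨θ, w, hθ, fun c a g hg => ⟨m, fun j _ hw => hsat j hw, ?_⟩⟩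
    obtain ⟨β, hβ, hW⟩ := hs c a g hg
    exact ⟨β, hβ, ih β hβ _ _ g hW⟩

/-- **THE SAME-RANK TRANSFER ALONG POINTWISE-SATURATED PLAYS (main induction).**  If `h` is pointwise-SAT-won with rank `< α` for
`(L, τ̄)` and `G` is a twisted cylinder over `h`, TC(G, h, τ, a) with `τ ≡ τ̄ (mod q)` and `q ∣ τ·r` on `L`, then `G` is graded-won
with rank `< α` for every lattice `L' ⊇ cylLattice L`.  Step: conjugate the coordinate change through the twist (res-type-099's
`conjMove`), play `(id, (W, 0))`; at a singular successor `G₁` at `γ`: the saturation-free correspondence (`isSuccessorAt_of_frobCover`)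
exhibits the slice's singular successor `h₁` at `γ|_{old}`, which releases the residue `m` of the point; `exists_exact_saturation` turns
the congruence into exact data `(m', K)`; `isSuccessorAt_of_twistedCyl_pointwise` makes the RE-CENTRED successor `G₁ ∘ (𝒪_K ⊔ y)` a
twisted cylinder over `h₁` (after identifying the two copies of `h₁` by uniqueness of the `s`-saturation); the induction hypothesis
and the transfer along the graded invertible re-centring (p527298) finish. [OURS · L1 W4.3] -/
theorem gradedWonBy_twistedCyl_of_psatWonBy (p e q : ℕ) [Fact p.Prime] [CharP k p] (hq : q = p ^ e) (α : Ordinal.{0}) :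
    ∀ {n : ℕ} (L : AddSubgroup (Fin (n + 1) → ℤ)) (τz : Fin (n + 1) → ZMod q) (h : MvPowerSeries (Fin (n + 1)) k),
      PSatWonBy q α (n + 1) L τz h →
      ∀ (τ : Fin (n + 1) → ℕ) (_ : ∀ i, ((τ i : ℕ) : ZMod q) = τz i) (_ : ∀ r ∈ L, (q : ℤ) ∣ ∑ i, (τ i : ℤ) * r i)
        (a : ℕ) (L' : AddSubgroup (Fin (n + 1 + 1) → ℤ)) (_ : cylLattice L ≤ L') (G : MvPowerSeries (Fin (n + 1 + 1)) k)
        (_ : subst (frobFamily (k := k) n q) G = (1 + X (Fin.last (n + 1))) ^ a * subst (scaleFam (k := k) τ) h),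
        GradedWonBy α (n + 1 + 1) L' G := by
  classical
  have hq0 : 0 < q := by rw [hq]; exact pow_pos (Nat.Prime.pos Fact.out) e
  haveI : NeZero q := ⟨hq0.ne'⟩
  induction α using WellFoundedLT.induction with
  | ind α ih =>
    intro n L τz h hsat τ hτ hL a L' hcyl G hTC
    haveI : CharP (MvPowerSeries (Fin (n + 1 + 1)) k) p := charP_of_injective_ringHom MvPowerSeries.C_injective p
    have hfrob : ((1 : MvPowerSeries (Fin (n + 1 + 1)) k) + X (Fin.last (n + 1))) ^ q = 1 + X (Fin.last (n + 1)) ^ q := by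
      rw [hq, add_pow_char_pow, one_pow]
    have hlast : (Pi.single (Fin.last (n + 1)) 1 : Fin (n + 1 + 1) → ℤ) ∈ L' := by
      refine hcyl ?_
      rw [mem_cylLattice_iff]
      have : (fun j : Fin (n + 1) => (Pi.single (Fin.last (n + 1)) (1 : ℤ) : Fin (n + 1 + 1) → ℤ) (Fin.castSucc j)) = 0 := by
        funext j; simp [(Fin.castSucc_lt_last j).ne]
      rw [this]; exact L.zero_mem
    -- unfold the pointwise-SAT-win of the slice
    rw [psatWonBy_iff] at hsat
    obtain ⟨θ, W, ⟨⟨hθ0, hθdet, hWpos⟩, hθgr⟩, hsucc⟩ := hsat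
    -- (1) conjugate the coordinate change through the twist
    set R : ℕ := ∑ l', τ l' with hR
    set τ2 : Fin (n + 1) → ℕ := fun l => τ l + q * R with hτ2
    have hdiv := hdiv_of_graded q hq0 L τ hL θ hθ0 hθgr
    obtain ⟨u, hu1, hu0, hu⟩ := exists_inv_one_add_X (k := k) (Fin.last (n + 1))
    have hTw : subst (frobFamily (k := k) n q) G = (1 + X (Fin.last (n + 1))) ^ a *
        subst (Fin.snoc (scaleFam (k := k) τ) (X (Fin.last (n + 1)))) (cylinder h) := by
      rw [hTC, subst_cylinder (hasSubst_snoc_scaleFam τ)]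
      congr 2
      funext j
      rw [Fin.snoc_castSucc]
    have hTC2 := subst_frobFamily_subst_conjMove hq0 hfrob hu hu1 hdiv hθ0 G h a
      (Fin.snoc (scaleFam (k := k) τ) (X (Fin.last (n + 1)))) (constantCoeff_snoc_scaleFam τ) (snoc_scaleFam_castSucc τ) hTw
    set Θ := conjMove q τ τ2 u θ with hΘ
    have hΘ0 : ∀ j, constantCoeff (Θ j) = 0 := constantCoeff_conjMove hθ0
    have hΘdet : IsUnit (linMat Θ).det := by
      change IsUnit (Matrix.of fun a b => coeff (Finsupp.single b 1) (Θ a)).det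
      rw [hΘ, det_linMat_conjMove hu hu0]; exact hθdet
    have hΘgr := conjMove_graded hq0 hfrob hu hu1 hdiv L L' hcyl hlast hθgr
    have hτ2z : ∀ j, ((τ2 j : ℕ) : ZMod q) = τz j := by
      intro j; rw [hτ2]; push_cast; rw [ZMod.natCast_self, zero_mul, add_zero, hτ j]
    have hL2 : ∀ r ∈ L, (q : ℤ) ∣ ∑ i, (τ2 i : ℤ) * r i := fun r hr =>
      dvd_tauDot_of_shift q τ τ2 (fun _ => R) (fun i => by rw [hτ2]) r (hL r hr)
    -- (2) the move `(id, (W, 0))` on `G ∘ Θ`; successors one point at a time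
    set G2 := subst Θ G with hG2
    have hG2won : GradedWonBy α (n + 1 + 1) L' G2 := by
      rw [gradedWonBy_iff]
      obtain ⟨i₀, hi₀⟩ := hWpos
      refine ⟨fun i => X i, Fin.snoc W 0, isLGradedMove_X L' _ ⟨Fin.castSucc i₀, by simpa using hi₀⟩, fun C A G₁ hS => ?_⟩
      set c' : Fin (n + 1) → k := fun l => C (Fin.castSucc l) with hc'
      -- the slice has a singular successor at `c'` with the same exponent: release the residue of the point
      obtain ⟨h₁, hS₁, -⟩ := isSuccessorAt_of_frobCover q hq0 τ2 a G2 (subst θ h) hTC2 W C A G₁ hS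
      obtain ⟨m, hcong, β, hβ, hsat₁⟩ := hsucc c' A h₁ (isSuccessorAt_of_subst h θ W c' A h₁ hS₁)
      -- exact saturation data at the point
      have hτ2mod : ∀ j, C (Fin.castSucc j) ≠ 0 → 0 < W j → τ2 j ≡ m.val * W j [MOD q] := by
        intro j hc hw
        have h1 : ((τ2 j : ℕ) : ZMod q) = ((m.val * W j : ℕ) : ZMod q) := by
          push_cast; rw [hτ2z j, hcong j hc hw, ZMod.natCast_zmod_val]
        exact (ZMod.natCast_eq_natCast_iff _ _ _).mp h1
      obtain ⟨m', K, hm', hex, hdom⟩ := exists_exact_saturation q τ2 hq0 W C m.val hτ2mod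
      -- the re-centred successor is a twisted cylinder over (the) `h₁`
      obtain ⟨h₁', hS₁', hTC₁⟩ := isSuccessorAt_of_twistedCyl_pointwise q τ2 a W C m' K hq0 hfrob (subst θ h) G2 hTC2 hex hdom A G₁ hS
      have heq : h₁' = h₁ := by
        obtain ⟨-, hf, hnd, -⟩ := hS₁
        obtain ⟨-, hf', hnd', -⟩ := hS₁'
        exact (eq_of_X_pow_mul_eq (hf'.symm.trans hf) hnd' hnd).2
      rw [heq] at hTC₁
      -- the induction hypothesis at the re-centred successor
      set Φ := (Fin.snoc (orbitSubst (k := k) K W c') (X (Fin.last (n + 1 + 1))) :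
        Fin (n + 1 + 1 + 1) → MvPowerSeries (Fin (n + 1 + 1 + 1)) k) with hΦ
      set L₁ := succLattice L' (Fin.snoc W 0 : Fin (n + 1 + 1) → ℕ) C with hL₁
      have hcyl₁ : cylLattice (succLattice L W c') ≤ L₁ := (cylLattice_succLattice_le L W C).trans (succLattice_mono hcyl _ _)
      have hlast₁ : (Pi.single (Fin.last (n + 1 + 1)) 1 : Fin (n + 1 + 1 + 1) → ℤ) ∈ L₁ := by
        refine hcyl₁ ?_
        rw [mem_cylLattice_iff]
        have : (fun j : Fin (n + 1 + 1) => (Pi.single (Fin.last (n + 1 + 1)) (1 : ℤ) : Fin (n + 1 + 1 + 1) → ℤ) (Fin.castSucc j)) = 0 := by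
          funext j; simp [(Fin.castSucc_lt_last j).ne]
        rw [this]; exact AddSubgroup.zero_mem _
      have htr₁ : ∀ l : Fin (n + 1), c' l ≠ 0 → 0 < W l → (Pi.single (Fin.castSucc l.succ) 1 : Fin (n + 1 + 1 + 1) → ℤ) ∈ L₁ := by
        intro l hcl hwl
        have h2 : (Pi.single (Fin.castSucc l).succ 1 : Fin (n + 1 + 1 + 1) → ℤ) ∈ L₁ :=
          AddSubgroup.subset_closure (Or.inr ⟨Fin.castSucc l, hcl, by simpa using hwl, rfl⟩)
        rwa [Fin.succ_castSucc] at h2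
      have hm'z : ((m' : ℕ) : ZMod q) = m := by
        rw [(ZMod.natCast_eq_natCast_iff _ _ _).mpr hm', ZMod.natCast_zmod_val]
      set τ3 : Fin (n + 1) → ℕ := τ2 + q • K with hτ3
      have hτ3z : ∀ j, ((τ3 j : ℕ) : ZMod q) = τz j := by
        intro j
        rw [hτ3, Pi.add_apply, Pi.smul_apply, smul_eq_mul]; push_cast
        rw [ZMod.natCast_self, zero_mul, add_zero, hτ2z j]
      have hdom3 : ∀ j, m' * W j ≤ τ3 j := by
        intro j
        by_cases hw : 0 < W j
        · exact hdom j hw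
        · rw [Nat.eq_zero_of_not_pos hw, mul_zero]; exact Nat.zero_le _
      have hwonΦ : GradedWonBy β (n + 1 + 1 + 1) L₁ (subst Φ G₁) := by
        refine ih β hβ (succLattice L W c') _ h₁ hsat₁ (succTau τ3 W m') ?_ ?_ (a + m' * A) L₁ hcyl₁ _ hTC₁
        · intro i
          refine Fin.cases ?_ (fun j => ?_) i
          · rw [succTau_zero, Fin.cons_zero, hm'z]
          · rw [succTau_succ, Fin.cons_succ, Nat.cast_sub (hdom3 j)]; push_cast
            rw [hτ3z, hm'z]
        · have hL3 : ∀ r ∈ L, (q : ℤ) ∣ ∑ i, (τ3 i : ℤ) * r i := fun r hr =>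
            dvd_tauDot_of_shift q τ2 τ3 K (fun i => by rw [hτ3, Pi.add_apply, Pi.smul_apply, smul_eq_mul]) r (hL2 r hr)
          exact dvd_tauDot_succLattice q τ3 W c' m' L hL3 hex hdom
      exact ⟨β, hβ, (gradedWonBy_subst_iff_of_graded β L₁ G₁ Φ (constantCoeff_snoc_orbitSubst K W c')
        (isUnit_det_linMat_snoc_orbitSubst K W c') (snoc_orbitSubst_graded K W c' L₁ hlast₁ htr₁)).mp hwonΦ⟩
    -- (3) transfer back along the conjugate move
    exact (gradedWonBy_subst_iff_of_graded α L' G Θ hΘ0 hΘdet hΘgr).mp hG2won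

end PSatGame

/-! ## The wild point: pointwise-SAT-won slice ⇒ successor won, same rank -/

section WildPointP

variable {n : ℕ} (w : Fin (n + 1) → ℕ) (c : Fin (n + 1) → k) (q : ℕ)

/-- **T3″ ALONG POINTWISE-SATURATED PLAYS, AT THE WILD POINT.**  At a frozen coordinate `v` = last with `c_v ≠ 0 < w_v`, `q = p^e ∣ w_v`,
`(w_v/q : k) ≠ 0` and `q ∣ wⱼ` for every translated `j` (the hypotheses of the (S2) stub verbatim): if the slice `g|_{y_v=0}` is
POINTWISE-SAT-WON with rank `< α` for the slice lattice and the residues `wildTau mod q = (1 ; q⌈wⱼ/q⌉ − wⱼ)`, then the successor `g`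
is won with rank `< α` in the graded game of the propagated lattice.  Special cases: `q = 1` is the tame theorem p515424
(`psatWonBy_one_of_gradedWonBy`), `α = 0` is res-type-099's rank-0 floor p529887 (`psatWonBy_zero_iff`), uniform saturation is file 18
(`psatWonBy_of_satWonBy`).  The same-rank statement WITHOUT any saturation (W-min) stays open. [OURS · L1 W4.3] -/
theorem gradedWonBy_of_slice_wild_psat (L : AddSubgroup (Fin (n + 1) → ℤ)) (F' : MvPowerSeries (Fin (n + 1)) k) (a : ℕ)
    (g : MvPowerSeries (Fin (n + 1 + 1)) k) (hfac : subst (CobordantGame.cruxChart k w c) F' = X 0 ^ a * g)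
    (hc : c (Fin.last n) ≠ 0) (hw : 0 < w (Fin.last n)) (p e : ℕ) [Fact p.Prime] [CharP k p] (hq : q = p ^ e)
    (hv : q ∣ w (Fin.last n)) (hE : ((w (Fin.last n) / q : ℕ) : k) ≠ 0) (hmin : ∀ j, j ≠ Fin.last n → c j ≠ 0 → q ∣ w j)
    (α : Ordinal.{0}) :
    PSatWonBy q α (n + 1) (sliceLattice (succLattice L w c) (Fin.last n)) (fun i => ((wildTau w q i : ℕ) : ZMod q))
        (sliceGerm (Fin.last n) g) →
      GradedWonBy α (n + 1 + 1) (succLattice L w c) g := by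
  classical
  intro hh
  haveI : CharP (MvPowerSeries (Fin (n + 1 + 1)) k) p := charP_of_injective_ringHom MvPowerSeries.C_injective p
  have hq0 : 0 < q := by rw [hq]; exact pow_pos (Nat.Prime.pos Fact.out) e
  have hfrob : ((1 : MvPowerSeries (Fin (n + 1 + 1)) k) + X (Fin.last (n + 1))) ^ q = 1 + X (Fin.last (n + 1)) ^ q := by
    rw [hq, add_pow_char_pow, one_pow]
  set L' := succLattice L w c with hL'
  have hgen : ∀ j : Fin (n + 1), c j ≠ 0 → 0 < w j → (Pi.single j.succ 1 : Fin (n + 1 + 1) → ℤ) ∈ L' :=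
    fun j hcj hwj => AddSubgroup.subset_closure (Or.inr ⟨j, hcj, hwj, rfl⟩)
  have hlast : (Pi.single (Fin.last (n + 1)) 1 : Fin (n + 1 + 1) → ℤ) ∈ L' := by
    rw [← Fin.succ_last]; exact hgen _ hc hw
  have hdvd : ∀ j, c j ≠ 0 → 0 < w j → q ∣ w j := by
    intro j hcj hwj
    by_cases hj : j = Fin.last n
    · subst hj; exact hv
    · exact hmin j hj hcj
  set G := subst (wildLambda w c q) g with hG
  have hGcov : subst (frobFamily (k := k) n q) G =
      (1 + X (Fin.last (n + 1))) ^ a * subst (scaleFam (k := k) (wildTau w q)) (sliceGerm (Fin.last n) g) :=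
    subst_frobFamily_wildLambda_eq_scaleFam w c q hq0 hfrob hw hv hmin F' a g hfac
  have hGwon : GradedWonBy α (n + 1 + 1) L' G :=
    gradedWonBy_twistedCyl_of_psatWonBy p e q hq α _ _ _ hh (wildTau w q) (fun _ => rfl)
      (dvd_wildTau_dot w c q hq0 L hdvd hv) a L' (cylLattice_sliceLattice_last_le L' hlast) G hGcov
  have hE' : ((ceilExp w q (Fin.last n) : ℕ) : k) ≠ 0 := by
    unfold ceilExp; rwa [ceilDiv_of_dvd _ _ hq0 hv]
  exact gradedWonBy_of_subst_wildLambda w c q α L' hlast hgen hc hE' g hGwon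

end WildPointP

end GradedGame

end Summit.ResolutionOfSingularities.ResolutionOfSingularities.Theorems
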